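import Literature.NumberTheory.EllipticCurves.KuriharaNumberKimShaLength
import Literature.NumberTheory.EllipticCurves.ModularCurvePeriodRatio
import Literature.NumberTheory.EllipticCurves.Rank1Residual.X10Proofs
import Literature.NumberTheory.EllipticCurves.Rank1Residual.Typed.KolyvaginCertificate
import Literature.NumberTheory.EllipticCurves.Rank1Residual.Typed.X11
import HarnessLib

/-!
# Kurihara-number certificates at a semi-stable prime `p ≥ 5` (Kim, Amer. J. Math. 2026, Thm. 1.8): consumers (cell `b2b-bsdres`)

HONEST FRAMING (run/shared/lean/b2b/bsd-rank1-residual/, verbatim): the goal of the cell is to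
DELETE the COMBINATION-SHAPED residual classes for ALL analytic-rank `≤ 1` elliptic curves over `ℚ`
— "full BSD formula for every rank `≤ 1` curve in class C" assembled STRICTLY from published
theorems — so that the rank-`≤ 1` remainder becomes exactly the CONSTRUCTION-SHAPED classes, which
are TYPED (missing-input `Prop`s), NOT attempted. This is not "finishing BSD".

Theorems only (no definition, no new named fact; prover x11a gen 12). Companions of
`Typed/VisibilityCertificate.lean` (rank `0`, lower bound from a congruent partner) and
`Typed/KolyvaginCertificate.lean` (rank `≤ 1` at `p ∤ #Ш_an`, certificate `Ш(E)[p] = 0`).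

**The lever** (RESIDUAL-CASES.md §a.1 row C15 / lever L5, "T-KIM0 / T-KIM1"; named facts
`Kim2022_rankZero_padicValRat_sha_of_kuriharaNumber_ne_zero`,
`Kim2022_rankOne_card_sha_eq_one_of_kuriharaNumber_ne_zero`, file `KuriharaNumberKimShaLength`).
C.-H. Kim, Amer. J. Math. 148 (2026) Thm. 1.8 (= arXiv:2203.12159v4 Thm. 1.9), clause (6): for
`p ≥ 5` with `ρ̄_{E,p}` surjective and the Manin constant prime to `p` — vacuous at a prime of good OR
MULTIPLICATIVE reduction (§1.3.5, Mazur 1978 Cor. 4.1) — and `ord(δ̃) < ∞` — automatic in analytic rank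
`0`, and in analytic rank `1` at a semi-stable prime (Cor. 1.6) —
`length_{ℤ_p} Ш(E/ℚ)[p^∞] = ∂^{(ord δ̃)}(δ̃) − ∂^{(∞)}(δ̃)`. ONE mod-`p` Kurihara number
`δ̃_n ≢ 0 (mod p)` (a finite modular-symbol computation: `δ̃_n = ∑_{a ∈ (ℤ/n)ˣ} [a/n]⁺ ∏ log_{η_ℓ}(a)`)
forces `∂^{(∞)} = 0`, whence in rank `0`: `ord_p #Ш(E/ℚ) = ord_p(L(E,1)/Ω_E)`, which is
`ord_p #Ш_an` as soon as `p ∤ ∏_ℓ c_ℓ · #E(ℚ)_tors` (`bsdp_of_kim_rankZero_of_kuriharaNumber_ne_zero`);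
in rank `1` (prime level `ℓ`): `Ш(E/ℚ)[p^∞] = 0`, which is BSD at `p` as soon as `ord_p #Ш_an = 0`
(`bsdp_of_kim_rankOne_of_kuriharaNumber_ne_zero`). NO second multiplicative prime ("(ram)"), NO main
conjecture, NO congruent partner is needed: at a multiplicative `p ≥ 5` with `ρ̄` onto this is — per
pair — exactly the input the class X11 lacks in print ((ram)-free main conjecture at `p ∥ N`; cell
files `Rank1Residual/X11.lean`, `Typed/X11.lean`). The X11 shapes are
`X11RankZero.bsdp_of_kim_of_kuriharaNumber_ne_zero` and `X11.bsdp_of_kim_rankOne_of_kuriharaNumber_ne_zero`.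

**Status of the inputs.** Kim Thm. 1.8/1.9 + Cor. 1.6: PUBLISHED (Amer. J. Math. 2026). Period
transfer `Ω(W) = u·Ω⁺_f`, `|u|_p = 1` (needed only to read the tree's `Ω⁺_f`-normalised
`kuriharaNumber` as Kim's Néron-normalised `δ̃_n` up to a unit): Greenberg–Vatsal 2000 Rem. 3.4 +
Mazur 1978 Cor. 4.1 + Edixhoven 1991 (`realPeriodRat_eq_unit_mul_plusPeriod_of_multiplicative`, named
fact, PUBLISHED). Gross–Zagier–Kolyvagin (`hGZK`, bsd.S17), modularity (`hmod`, to read `r_an = 0` as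
`L(E,1) ≠ 0` and to have the newform `f`). Per pair (the CERTIFICATE, lane's): the Kolyvagin level
`n` (primes `ℓ ≡ 1`, `a_ℓ ≡ ℓ + 1 (mod p)`, `ℓ ∤ Np`, with `#Ẽ(𝔽_ℓ)[p] ≤ p`), surjective discrete
logarithms `ψ_ℓ`, and `δ̃_n ≢ 0 (mod p)`; `p ∤ ∏ c_ℓ`, `p ∤ #E(ℚ)_tors` (rank `0`) / `ord_p #Ш_an = 0`
(rank `1`). NOT a class theorem; nothing here changes a label (the lane books pairs: two engines +
referee). Where it bites: all 158 rank-`0` X11-type pairs with `p ∣ #Ш_an` of the cell's extension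
list (`p ≥ 5`, `N < 5·10⁵`; 152 of them with `p ∤ ∏ c_ℓ`), in particular the two census pairs
`10580l1@5`, `17640l1@5` (`#Ш_an = 25`, `∏ c_ℓ = 2`, `#E(ℚ)_tors = 1`), and the rank-`1` X11 pairs at
`p ≥ 5` with `p ∤ #Ш_an · ∏ c_ℓ`; numbers in `b2b-bsdres-x11a/REPORT-g12.md` (two engines of the
kurihara lane run at `p ∥ N`).

References: Kim 2026 [Kim2022StructureSelmer]; Mazur 1978 Cor. 4.1 [Mazur1978]; Greenberg–Vatsal 2000
Rem. 3.4 [GreenbergVatsal2000]; Miller 2011 Def. 1.1 [Miller2011LMS].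
-/

noncomputable section

open scoped Classical MatrixGroups ModularForm

open CongruenceSubgroup WeierstrassCurve Literature.NumberTheory.EllipticCurves
  Literature.NumberTheory.EllipticCurves.ModularForms
  Literature.NumberTheory.EllipticCurves.Rank1Residual

namespace Literature.NumberTheory.EllipticCurves.Rank1Residual.Typed

variable (W : WeierstrassCurve ℚ) [W.IsElliptic] [W.IsGloballyMinimal] (p : ℕ) [Fact p.Prime]

/-! ### Rank `0`, class-agnostic -/

/-- **`BSD(E,p)` in analytic rank `0` from ONE unit Kurihara number at a semi-stable prime `p ≥ 5`
with `ρ̄_{E,p}` onto** (Kim 2026 Thm. 1.8 (6), named fact `hKim`; Gross–Zagier–Kolyvagin `hGZK`).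
Hypotheses: `p ≥ 5` of good or multiplicative reduction; `ρ̄_{E,p}` surjective; `L(E,1) ≠ 0`;
`p ∤ ∏_ℓ c_ℓ` and `p ∤ #E(ℚ)_tors`; the newform `f` of `W` with the period transfer
`Ω(W) = u·Ω⁺_f`, `|u|_p = 1`; a level `n ∈ 𝒩_1` with cyclic reductions and surjective discrete
logarithms `ψ`, and the certificate `kuriharaNumber f p n ψ ≠ 0`. Then Kim's (6) gives
`ord_p #Ш = ord_p(L(E,1)/Ω(W))`, i.e. `L(E,1) = q·Ω(W)` with
`ord_p q = ord_p #Ш + ord_p ∏ c_ℓ − 2 ord_p #E(ℚ)_tors` (the last two terms being `0`), which is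
Miller's `BSD(E,p)` by `bsdp_of_padicValRat_eq`. Per pair; NOT a class theorem.
[cite: Kim2022StructureSelmer, Thm. 1.9 (6) (PDF p. 8), Cor. 1.6] [cite: Miller2011LMS, Def. 1.1] -/
theorem bsdp_of_kim_rankZero_of_kuriharaNumber_ne_zero
    (hKim : Kim2022_rankZero_padicValRat_sha_of_kuriharaNumber_ne_zero)
    (hGZK : rank_eq_analyticRank_of_analyticRank_le_one) (hp : 5 ≤ p)
    (hsst : W.HasGoodReductionAtPrime p ∨ W.HasMultiplicativeReductionAtPrime p)
    (hsurj : W.HasSurjectiveModNGaloisRep p) (hL : W.entireLFunction 1 ≠ 0)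
    (htam : ¬ p ∣ W.tamagawaProduct) (htors : ¬ p ∣ W.torsionOrder)
    {N : ℕ} [NeZero N] (f : CuspForm (Gamma0 N) 2) (hf : IsNewformOf W f)
    (hper : ∃ u : ℚ, ‖(u : ℚ_[p])‖ = 1 ∧ W.realPeriodRat = u * plusPeriod f)
    (n : ℕ) [NeZero n] (hn : Kato.IsKolyvaginProduct W p 1 n)
    (hcyc : ∀ (ℓ : ℕ) [Fact ℓ.Prime], ℓ ∣ n →
      Nat.card {P : ((WeierstrassCurve.integralModelInt W).map
          (Int.castRingHom (ZMod ℓ))).toAffine.Point // p • P = 0} ≤ p)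
    (ψ : (ℓ : ℕ) → (ZMod ℓ)ˣ →* Multiplicative (ZMod (p ^ 1)))
    (hψ : ∀ ℓ ∈ n.primeFactors, Function.Surjective (ψ ℓ))
    (hδ : kuriharaNumber f (p ^ 1) n ψ ≠ 0) : BSDp W p := by
  have hr0 : W.analyticRank = 0 := analyticRank_eq_zero_of_entireLFunction_one_ne_zero hL
  obtain ⟨hmw, hfin⟩ := hGZK W (by rw [hr0]; exact zero_le_one)
  have hmw0 : W.mordellWeilRank = 0 := by rw [hmw, hr0]
  obtain ⟨q, hq, hval⟩ := hKim W p hp hsst hsurj hL hfin f hf hper n hn hcyc ψ hψ hδ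
  have hΩpos : 0 < W.realPeriodRat := by
    haveI : (W.baseChange ℝ).IsElliptic := by rw [baseChange]; infer_instance
    exact (W.baseChange ℝ).realPeriod_pos'
  have hΩ : (W.realPeriodRat : ℂ) ≠ 0 := by exact_mod_cast hΩpos.ne'
  rw [div_eq_iff hΩ] at hq
  have hq0 : q ≠ 0 := by
    rintro rfl
    apply hL
    rw [hq]; simp
  haveI : Finite W.sha := hfin
  have hsha : padicValNat p (Nat.card (AddCommGroup.primaryComponent W.sha p)) =
      padicValNat p W.shaOrder := by
    unfold WeierstrassCurve.shaOrder
    exact padicValNat_card_addPrimaryComponent p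
  have htam0 : padicValNat p W.tamagawaProduct = 0 := padicValNat.eq_zero_of_not_dvd htam
  have htors0 : padicValNat p W.torsionOrder = 0 := padicValNat.eq_zero_of_not_dvd htors
  refine bsdp_of_padicValRat_eq p hmw hfin q hq0 ?_ ?_
  · rw [WeierstrassCurve.leadingLCoeff, hr0, iteratedDeriv_zero, Nat.factorial_zero, Nat.cast_one,
      div_one, W.regulator_eq_one_of_rank_zero hmw0, mul_one, hq]
    push_cast; ring
  · rw [hval, hsha, htam0, htors0]
    push_cast; ring

/-! ### Rank `0`, class X11 (`p ∥ N`, `ρ̄` surjective) -/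

/-- **X11 ∧ `r = 0` at `p ≥ 5` with `ρ̄_{E,p}` surjective: `BSD(E,p)` from PUBLISHED theorems plus
ONE Kurihara-number certificate** — census shape over the cell's predicates. Inputs: Kim 2026
Thm. 1.8 (6) (`hKim`), the period transfer at a multiplicative prime (`hϖ`, Greenberg–Vatsal +
Mazur Cor. 4.1), Gross–Zagier–Kolyvagin (`hGZK`), modularity (`hmod`); per pair: `p ∤ ∏ c_ℓ`,
`p ∤ #E(ℚ)_tors`, the newform `f`, the level `n`, `ψ`, and `δ̃_n ≢ 0 (mod p)`. No (ram), no main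
conjecture, no partner. Per pair; NOT a deletion of X11's rank-`0` clause.
[cite: Kim2022StructureSelmer, Thm. 1.9 (6) (PDF p. 8), Cor. 1.6] [cite: Miller2011LMS, Def. 1.1] -/
theorem X11RankZero.bsdp_of_kim_of_kuriharaNumber_ne_zero
    (hKim : Kim2022_rankZero_padicValRat_sha_of_kuriharaNumber_ne_zero)
    (hϖ : realPeriodRat_eq_unit_mul_plusPeriod_of_multiplicative)
    (hGZK : rank_eq_analyticRank_of_analyticRank_le_one) (hmod : hasEntireLFunction_rat)
    (hp : 5 ≤ p) (hr : W.analyticRank = 0) (hX : ClassX11 W p) (hsurj : Surj W p)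
    (htam : ¬ p ∣ W.tamagawaProduct) (htors : ¬ p ∣ W.torsionOrder)
    {N : ℕ} [NeZero N] (f : CuspForm (Gamma0 N) 2) (hf : IsNewformOf W f)
    (n : ℕ) [NeZero n] (hn : Kato.IsKolyvaginProduct W p 1 n)
    (hcyc : ∀ (ℓ : ℕ) [Fact ℓ.Prime], ℓ ∣ n →
      Nat.card {P : ((WeierstrassCurve.integralModelInt W).map
          (Int.castRingHom (ZMod ℓ))).toAffine.Point // p • P = 0} ≤ p)
    (ψ : (ℓ : ℕ) → (ZMod ℓ)ˣ →* Multiplicative (ZMod (p ^ 1)))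
    (hψ : ∀ ℓ ∈ n.primeFactors, Function.Surjective (ψ ℓ))
    (hδ : kuriharaNumber f (p ^ 1) n ψ ≠ 0) : BSDp W p :=
  bsdp_of_kim_rankZero_of_kuriharaNumber_ne_zero W p hKim hGZK hp (Or.inr hX.1) hsurj
    ((W.analyticRank_eq_zero_iff_holds (hmod W)).mp hr) htam htors f hf
    (hϖ W p hp hX.1 hX.2.1 f hf) n hn hcyc ψ hψ hδ

/-! ### Rank `1`, class-agnostic and class X11 -/

omit [W.IsElliptic] [W.IsGloballyMinimal] [Fact p.Prime] in
/-- If the `p`-primary component of `Ш(E/ℚ)` is trivial then `Ш(E/ℚ)[p] = 0` (an element killed by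
`p` lies in the `p`-primary component). [folklore] -/
theorem noPTorsion_of_card_primaryComponent_eq_one
    (h : Nat.card (AddCommGroup.primaryComponent W.sha p) = 1) :
    ∀ x : W.sha, (p : ℤ) • x = 0 → x = 0 := by
  intro x hx
  have hmem : x ∈ AddCommGroup.primaryComponent W.sha p :=
    (AddCommGroup.mem_primaryComponent).mpr ⟨1, by rw [pow_one, ← natCast_zsmul]; exact hx⟩
  haveI : Finite (AddCommGroup.primaryComponent W.sha p) := Nat.finite_of_card_ne_zero (by rw [h]; norm_num)
  have hsub : Subsingleton (AddCommGroup.primaryComponent W.sha p) :=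
    Finite.card_le_one_iff_subsingleton.mp h.le
  have := hsub.elim ⟨x, hmem⟩ ⟨0, AddSubgroup.zero_mem _⟩
  exact congrArg Subtype.val this

/-- **`BSD(E,p)` in analytic rank `1` from ONE unit Kurihara number at a PRIME level, at a semi-stable
prime `p ≥ 5` with `ρ̄_{E,p}` onto and `ord_p #Ш_an = 0`** (Kim 2026 Thm. 1.8 (6) with Cor. 1.6,
named fact `hKim`: `Ш(E/ℚ)[p^∞] = 0`; then `Typed.bsdp_of_shaAn_unit_of_noPTorsion`, inputs
Gross–Zagier–Kolyvagin `hGZK` and the lane's exact `#Ш_an = q` with `ord_p q = 0`). Per pair; NOT a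
class theorem. [cite: Kim2022StructureSelmer, Thm. 1.9 (6) (PDF p. 8), Cor. 1.6]
[cite: Miller2011LMS, Def. 1.1] -/
theorem bsdp_of_kim_rankOne_of_kuriharaNumber_ne_zero
    (hKim : Kim2022_rankOne_card_sha_eq_one_of_kuriharaNumber_ne_zero)
    (hGZK : rank_eq_analyticRank_of_analyticRank_le_one) (hp : 5 ≤ p)
    (hsst : W.HasGoodReductionAtPrime p ∨ W.HasMultiplicativeReductionAtPrime p)
    (hsurj : W.HasSurjectiveModNGaloisRep p) (hL : W.entireLFunction 1 = 0)
    (hr : W.analyticRank = 1) {q : ℚ} (hq : shaAn W = (q : ℂ)) (hv : padicValRat p q = 0)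
    {N : ℕ} [NeZero N] (f : CuspForm (Gamma0 N) 2) (hf : IsNewformOf W f)
    (hper : ∃ u : ℚ, ‖(u : ℚ_[p])‖ = 1 ∧ W.realPeriodRat = u * plusPeriod f)
    (ℓ : ℕ) [Fact ℓ.Prime] (hℓ : Kato.IsKolyvaginPrime W p 1 ℓ)
    (hcyc : Nat.card {P : ((WeierstrassCurve.integralModelInt W).map
        (Int.castRingHom (ZMod ℓ))).toAffine.Point // p • P = 0} ≤ p)
    (ψ : (ℓ' : ℕ) → (ZMod ℓ')ˣ →* Multiplicative (ZMod (p ^ 1)))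
    (hψ : Function.Surjective (ψ ℓ)) (hδ : kuriharaNumber f (p ^ 1) ℓ ψ ≠ 0) : BSDp W p := by
  have hr1 : W.analyticRank ≤ 1 := by rw [hr]
  obtain ⟨-, hfin⟩ := hGZK W hr1
  have hcard := hKim W p hp hsst hsurj hL hr hfin f hf hper ℓ hℓ hcyc ψ hψ hδ
  exact bsdp_of_shaAn_unit_of_noPTorsion W p hGZK hr1 hq hv
    (noPTorsion_of_card_primaryComponent_eq_one W p hcard)

/-- **X11 ∧ `r = 1` at `p ≥ 5` with `ρ̄_{E,p}` surjective and `ord_p #Ш_an = 0`: `BSD(E,p)` from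
PUBLISHED theorems plus ONE Kurihara-number certificate at a prime level** — census shape. Inputs:
Kim 2026 Thm. 1.8 (6) + Cor. 1.6 (`hKim`; "analytic rank one and semi-stable reduction at `p`" —
multiplicative reduction is semi-stable), the period transfer at `p ∥ N` (`hϖ`),
Gross–Zagier–Kolyvagin (`hGZK`), modularity (`hmod`, to read `r_an = 1` as `L(E,1) = 0`); per pair:
`#Ш_an = q` with `ord_p q = 0`, the newform `f`, the Kolyvagin prime `ℓ`, `ψ`, `δ̃_ℓ ≢ 0 (mod p)`.
No (ram), no anticyclotomic main conjecture, no Heegner index. Per pair; NOT a deletion of X11's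
rank-`1` clauses. [cite: Kim2022StructureSelmer, Thm. 1.9 (6) (PDF p. 8), Cor. 1.6]
[cite: Miller2011LMS, Def. 1.1] -/
theorem X11.bsdp_of_kim_rankOne_of_kuriharaNumber_ne_zero
    (hKim : Kim2022_rankOne_card_sha_eq_one_of_kuriharaNumber_ne_zero)
    (hϖ : realPeriodRat_eq_unit_mul_plusPeriod_of_multiplicative)
    (hGZK : rank_eq_analyticRank_of_analyticRank_le_one) (hmod : hasEntireLFunction_rat)
    (hp : 5 ≤ p) (hr : W.analyticRank = 1) (hX : ClassX11 W p) (hsurj : Surj W p)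
    {q : ℚ} (hq : shaAn W = (q : ℂ)) (hv : padicValRat p q = 0)
    {N : ℕ} [NeZero N] (f : CuspForm (Gamma0 N) 2) (hf : IsNewformOf W f)
    (ℓ : ℕ) [Fact ℓ.Prime] (hℓ : Kato.IsKolyvaginPrime W p 1 ℓ)
    (hcyc : Nat.card {P : ((WeierstrassCurve.integralModelInt W).map
        (Int.castRingHom (ZMod ℓ))).toAffine.Point // p • P = 0} ≤ p)
    (ψ : (ℓ' : ℕ) → (ZMod ℓ')ˣ →* Multiplicative (ZMod (p ^ 1)))
    (hψ : Function.Surjective (ψ ℓ)) (hδ : kuriharaNumber f (p ^ 1) ℓ ψ ≠ 0) : BSDp W p := by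
  have hL : W.entireLFunction 1 = 0 := by
    by_contra hne
    have h0 := (W.analyticRank_eq_zero_iff_holds (hmod W)).mpr hne
    omega
  exact Typed.bsdp_of_kim_rankOne_of_kuriharaNumber_ne_zero W p hKim hGZK hp (Or.inr hX.1) hsurj hL
    hr hq hv f hf (hϖ W p hp hX.1 hX.2.1 f hf) ℓ hℓ hcyc ψ hψ hδ

/-! ### The typed rank-zero input of `Typed/X11.lean`, discharged per pair by the Kurihara certificate

Appendix (x11a gen 12, same day): the cell's typed currency for X11 ∧ `r = 0` is
`X11RankZero.MissingInputAt W p` (`Typed/X11.lean`: the LOWER bound `ord_p #Ш_an ≤ ord_p #Ш` under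
surjectivity). Gen 8 discharged it by the Cassels certificate `p ∣ #Ш` (`X11RankZeroCertificate.lean`);
here it is discharged by ONE unit Kurihara number, through `BSD(E,p)` itself
(`missingPPartAt_of_bsdp`, `lower_and_upper_of_missingPPartAt`). Per pair; bookkeeping only. -/

/-- **X11 ∧ `r = 0`, `p ≥ 5`, `ρ̄_{E,p}` surjective, `p ∤ ∏c_ℓ·#E(ℚ)_tors`: the typed input
`X11RankZero.MissingInputAt W p` holds given ONE unit Kurihara number** (Kim 2026 Thm. 1.8 (6) via
`X11RankZero.bsdp_of_kim_of_kuriharaNumber_ne_zero`, then `missingPPartAt_of_bsdp`). Per pair; NOT a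
class theorem. [cite: Kim2022StructureSelmer, Thm. 1.9 (6) (PDF p. 8), Cor. 1.6]
[cite: Miller2011LMS, Def. 1.1] -/
theorem X11RankZero.missingInputAt_of_kim_of_kuriharaNumber_ne_zero
    (hKim : Kim2022_rankZero_padicValRat_sha_of_kuriharaNumber_ne_zero)
    (hϖ : realPeriodRat_eq_unit_mul_plusPeriod_of_multiplicative)
    (hGZK : rank_eq_analyticRank_of_analyticRank_le_one) (hmod : hasEntireLFunction_rat)
    (hp : 5 ≤ p) (hr : W.analyticRank = 0) (hX : ClassX11 W p) (hsurj : Surj W p)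
    (htam : ¬ p ∣ W.tamagawaProduct) (htors : ¬ p ∣ W.torsionOrder)
    {N : ℕ} [NeZero N] (f : CuspForm (Gamma0 N) 2) (hf : IsNewformOf W f)
    (n : ℕ) [NeZero n] (hn : Kato.IsKolyvaginProduct W p 1 n)
    (hcyc : ∀ (ℓ : ℕ) [Fact ℓ.Prime], ℓ ∣ n →
      Nat.card {P : ((WeierstrassCurve.integralModelInt W).map
          (Int.castRingHom (ZMod ℓ))).toAffine.Point // p • P = 0} ≤ p)
    (ψ : (ℓ : ℕ) → (ZMod ℓ)ˣ →* Multiplicative (ZMod (p ^ 1)))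
    (hψ : ∀ ℓ ∈ n.primeFactors, Function.Surjective (ψ ℓ))
    (hδ : kuriharaNumber f (p ^ 1) n ψ ≠ 0) : X11RankZero.MissingInputAt W p := by
  haveI : Finite W.sha := (hGZK W (by rw [hr]; exact zero_le_one)).2
  have hB := X11RankZero.bsdp_of_kim_of_kuriharaNumber_ne_zero W p hKim hϖ hGZK hmod hp hr hX hsurj htam
    htors f hf n hn hcyc ψ hψ hδ
  have hPP := missingPPartAt_of_bsdp W p hB
  exact ⟨fun _ => (lower_and_upper_of_missingPPartAt W p hPP).1, fun h => absurd hsurj h⟩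

end Literature.NumberTheory.EllipticCurves.Rank1Residual.Typed

end
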